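import Summits.MatrixMultiplication.MatrixMultiplication.Theorems.SoloInformedValNormalForm

/-!
# SoloInformedValSmall — an equilateral-trapezoid-free triple in `{0,…,232}` with `236` solutions

Pratt [arXiv:2309.03878 (ITCS 2024), Def. 4.2]: `Val(n)` is the maximum number of solutions of `a + b + c = n`
over equilateral-trapezoid-free `A, B, C ⊆ {0,…,n}`; the star `({0}, [0,n], [0,n])` gives `Val(n) ≥ n + 1`.
The base instance of this seat's construction (`SoloInformedValTrapezoid`, `SoloInformedValNormalForm`) has
`n = 53344`.  This file kernel-checks a member of the soloist's *sign-coherent* family (gen 68, dossier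
`paper/val-superlinear.md` §13, Theorem F): two words `u₁ = (A,B,C) ↦ places (0,1,2)`, `u₂ = (C,A,B) ↦ (0,1,2)`,
weights `(1, 5, 30)`, and per-(word, place) digit INTERVALS of one sign each —
`u₁`: `A`-digits `-[1,4]`, `B`-digits `[1,4]`, `C`-digits `-[2,7]`; `u₂`: `C`-digits `[1,4]`, `A`-digits `[1,5]`,
`B`-digits `[2,8]` — so that no hole `{0, ±1}` is needed anywhere: sign coherence alone excludes every unintended
solution.  The difference sets are

* `X = {5y + x} ∪ {30z - 5y'}`, `Y = {-30c - 5y} ∪ {x' - 30z}`, `Z = {30c - x} ∪ {5y' - x'}`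
  (`x x' ∈ [1,4]`, `y ∈ [1,4]`, `y' ∈ [1,5]`, `c ∈ [2,7]`, `z ∈ [2,8]`).

Results (namespace `…SoloVal.Small`):

* `tri` : `u + v + w = 0` on `X × Y × Z` forces one of the two intended digit patterns (`omega` on 8 cases);
* `trapezoidFree_XYZ` : `(X, Y, Z)` is equilateral trapezoid-free for the target `0`;
* `card_solutions_ge` : at least `236 = 4·4·6 + 4·5·7` solutions;
* `X_bound`, `Y_bound`, `Z_bound` : `X ⊆ [6, 235]`, `Y ⊆ [-239, -56]`, `Z ⊆ [1, 209]`;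
* `val_232` : after translating by `(-6, 239, -1)`: `A, B, C ⊆ {0,…,232}`, trapezoid-free for the target `232`,
  with at least `236 > 233` solutions — `Val(232) ≥ 236`, the smallest `n` with `Val(n) > n + 1` known to the seat
  (exhaustive search gives `Val(n) = n + 1` for `n ≤ 12`).  The triple is lopsided (`max A + max B + max C > 2·232`),
  so it is not a `Config` and enters no digit product; it is profile data, not an exponent.

Standard axioms only; every proof is `omega` on at most a dozen bounded digits.
-/

namespace Summit.MatrixMultiplication.MatrixMultiplication.Theorems.SoloVal.Small

open Finset

/-- Bottom digits (magnitudes) `[1, 4]`. -/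
noncomputable def I₀ : Finset ℤ := Icc 1 4
/-- Middle digits of `u₁` (`B`): `[1, 4]`. -/
noncomputable def R₁ : Finset ℤ := Icc 1 4
/-- Middle digits of `u₂` (`A`): `[1, 5]`. -/
noncomputable def Q₁ : Finset ℤ := Icc 1 5
/-- Top digits of `u₁` (`C`, magnitudes): `[2, 7]`. -/
noncomputable def T₁ : Finset ℤ := Icc 2 7
/-- Top digits of `u₂` (`B`): `[2, 8]`. -/
noncomputable def T₂ : Finset ℤ := Icc 2 8

/-- Bounds of `I₀`. -/
theorem I₀_bd {d : ℤ} (h : d ∈ I₀) : 1 ≤ d ∧ d ≤ 4 := by simpa [I₀] using h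
/-- Bounds of `R₁`. -/
theorem R₁_bd {d : ℤ} (h : d ∈ R₁) : 1 ≤ d ∧ d ≤ 4 := by simpa [R₁] using h
/-- Bounds of `Q₁`. -/
theorem Q₁_bd {d : ℤ} (h : d ∈ Q₁) : 1 ≤ d ∧ d ≤ 5 := by simpa [Q₁] using h
/-- Bounds of `T₁`. -/
theorem T₁_bd {d : ℤ} (h : d ∈ T₁) : 2 ≤ d ∧ d ≤ 7 := by simpa [T₁] using h
/-- Bounds of `T₂`. -/
theorem T₂_bd {d : ℤ} (h : d ∈ T₂) : 2 ≤ d ∧ d ≤ 8 := by simpa [T₂] using h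

/-- `X₁ = {5y + x : y ∈ R₁, x ∈ I₀}` (word `u₁`, `B - A`). -/
noncomputable def X1 : Finset ℤ := (R₁ ×ˢ I₀).image (fun p => 5 * p.1 + p.2)
/-- `X₂ = {30z - 5y' : z ∈ T₂, y' ∈ Q₁}` (word `u₂`, `B - A`). -/
noncomputable def X2 : Finset ℤ := (T₂ ×ˢ Q₁).image (fun p => 30 * p.1 - 5 * p.2)
/-- `Y₁ = {-30c - 5y : c ∈ T₁, y ∈ R₁}` (word `u₁`, `C - B`). -/
noncomputable def Y1 : Finset ℤ := (T₁ ×ˢ R₁).image (fun p => -30 * p.1 - 5 * p.2)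
/-- `Y₂ = {x' - 30z : x' ∈ I₀, z ∈ T₂}` (word `u₂`, `C - B`). -/
noncomputable def Y2 : Finset ℤ := (I₀ ×ˢ T₂).image (fun p => p.1 - 30 * p.2)
/-- `Z₁ = {30c - x : c ∈ T₁, x ∈ I₀}` (word `u₁`, `A - C`). -/
noncomputable def Z1 : Finset ℤ := (T₁ ×ˢ I₀).image (fun p => 30 * p.1 - p.2)
/-- `Z₂ = {5y' - x' : y' ∈ Q₁, x' ∈ I₀}` (word `u₂`, `A - C`). -/
noncomputable def Z2 : Finset ℤ := (Q₁ ×ˢ I₀).image (fun p => 5 * p.1 - p.2)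

/-- `X = X₁ ∪ X₂` (irreducible: never evaluated by elaboration). -/
@[irreducible] noncomputable def X : Finset ℤ := X1 ∪ X2
/-- `Y = Y₁ ∪ Y₂`. -/
@[irreducible] noncomputable def Y : Finset ℤ := Y1 ∪ Y2
/-- `Z = Z₁ ∪ Z₂`. -/
@[irreducible] noncomputable def Z : Finset ℤ := Z1 ∪ Z2

/-- Membership in an image of a product of two finsets under a two-variable map. -/
theorem mem_img {S S' : Finset ℤ} {f : ℤ → ℤ → ℤ} {v : ℤ} :
    v ∈ (S ×ˢ S').image (fun p => f p.1 p.2) ↔ ∃ a b, a ∈ S ∧ b ∈ S' ∧ f a b = v := by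
  constructor
  · intro h
    obtain ⟨⟨a, b⟩, hab, rfl⟩ := mem_image.1 h
    exact ⟨a, b, (mem_product.1 hab).1, (mem_product.1 hab).2, rfl⟩
  · rintro ⟨a, b, ha, hb, rfl⟩
    exact mem_image.2 ⟨(a, b), mem_product.2 ⟨ha, hb⟩, rfl⟩

/-- Membership in `X₁`. -/
theorem mem_X1 {v : ℤ} : v ∈ X1 ↔ ∃ a b, a ∈ R₁ ∧ b ∈ I₀ ∧ 5 * a + b = v := mem_img (f := fun a b => 5 * a + b)
/-- Membership in `X₂`. -/
theorem mem_X2 {v : ℤ} : v ∈ X2 ↔ ∃ a b, a ∈ T₂ ∧ b ∈ Q₁ ∧ 30 * a - 5 * b = v :=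
  mem_img (f := fun a b => 30 * a - 5 * b)
/-- Membership in `Y₁`. -/
theorem mem_Y1 {v : ℤ} : v ∈ Y1 ↔ ∃ a b, a ∈ T₁ ∧ b ∈ R₁ ∧ -30 * a - 5 * b = v :=
  mem_img (f := fun a b => -30 * a - 5 * b)
/-- Membership in `Y₂`. -/
theorem mem_Y2 {v : ℤ} : v ∈ Y2 ↔ ∃ a b, a ∈ I₀ ∧ b ∈ T₂ ∧ a - 30 * b = v := mem_img (f := fun a b => a - 30 * b)
/-- Membership in `Z₁`. -/
theorem mem_Z1 {v : ℤ} : v ∈ Z1 ↔ ∃ a b, a ∈ T₁ ∧ b ∈ I₀ ∧ 30 * a - b = v := mem_img (f := fun a b => 30 * a - b)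
/-- Membership in `Z₂`. -/
theorem mem_Z2 {v : ℤ} : v ∈ Z2 ↔ ∃ a b, a ∈ Q₁ ∧ b ∈ I₀ ∧ 5 * a - b = v := mem_img (f := fun a b => 5 * a - b)

/-- The solution equation on `X × Y × Z` forces one of the two intended digit patterns. -/
theorem tri {u v w : ℤ} (hu : u ∈ X) (hv : v ∈ Y) (hw : w ∈ Z) (h : u + v + w = 0) :
    (∃ x y c, (1 ≤ x ∧ x ≤ 4) ∧ (1 ≤ y ∧ y ≤ 4) ∧ (2 ≤ c ∧ c ≤ 7) ∧
        u = 5 * y + x ∧ v = -30 * c - 5 * y ∧ w = 30 * c - x) ∨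
    (∃ x y z, (1 ≤ x ∧ x ≤ 4) ∧ (1 ≤ y ∧ y ≤ 5) ∧ (2 ≤ z ∧ z ≤ 8) ∧
        u = 30 * z - 5 * y ∧ v = x - 30 * z ∧ w = 5 * y - x) := by
  simp only [X, Y, Z, mem_union, mem_X1, mem_X2, mem_Y1, mem_Y2, mem_Z1, mem_Z2] at hu hv hw
  rcases hu with ⟨a1, b1, ha1, hb1, rfl⟩ | ⟨a1, b1, ha1, hb1, rfl⟩ <;>
  rcases hv with ⟨a2, b2, ha2, hb2, rfl⟩ | ⟨a2, b2, ha2, hb2, rfl⟩ <;>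
  rcases hw with ⟨a3, b3, ha3, hb3, rfl⟩ | ⟨a3, b3, ha3, hb3, rfl⟩
  -- (X₁,Y₁,Z₁): intended pattern 1
  · obtain ⟨_, _⟩ := R₁_bd ha1; obtain ⟨_, _⟩ := I₀_bd hb1; obtain ⟨_, _⟩ := T₁_bd ha2
    obtain ⟨_, _⟩ := R₁_bd hb2; obtain ⟨_, _⟩ := T₁_bd ha3; obtain ⟨_, _⟩ := I₀_bd hb3
    exact Or.inl ⟨b1, a1, a2, I₀_bd hb1, R₁_bd ha1, T₁_bd ha2, by omega, by omega, by omega⟩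
  -- (X₁,Y₁,Z₂)
  · obtain ⟨_, _⟩ := R₁_bd ha1; obtain ⟨_, _⟩ := I₀_bd hb1; obtain ⟨_, _⟩ := T₁_bd ha2
    obtain ⟨_, _⟩ := R₁_bd hb2; obtain ⟨_, _⟩ := Q₁_bd ha3; obtain ⟨_, _⟩ := I₀_bd hb3
    omega
  -- (X₁,Y₂,Z₁)
  · obtain ⟨_, _⟩ := R₁_bd ha1; obtain ⟨_, _⟩ := I₀_bd hb1; obtain ⟨_, _⟩ := I₀_bd ha2
    obtain ⟨_, _⟩ := T₂_bd hb2; obtain ⟨_, _⟩ := T₁_bd ha3; obtain ⟨_, _⟩ := I₀_bd hb3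
    omega
  -- (X₁,Y₂,Z₂)
  · obtain ⟨_, _⟩ := R₁_bd ha1; obtain ⟨_, _⟩ := I₀_bd hb1; obtain ⟨_, _⟩ := I₀_bd ha2
    obtain ⟨_, _⟩ := T₂_bd hb2; obtain ⟨_, _⟩ := Q₁_bd ha3; obtain ⟨_, _⟩ := I₀_bd hb3
    omega
  -- (X₂,Y₁,Z₁)
  · obtain ⟨_, _⟩ := T₂_bd ha1; obtain ⟨_, _⟩ := Q₁_bd hb1; obtain ⟨_, _⟩ := T₁_bd ha2
    obtain ⟨_, _⟩ := R₁_bd hb2; obtain ⟨_, _⟩ := T₁_bd ha3; obtain ⟨_, _⟩ := I₀_bd hb3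
    omega
  -- (X₂,Y₁,Z₂)
  · obtain ⟨_, _⟩ := T₂_bd ha1; obtain ⟨_, _⟩ := Q₁_bd hb1; obtain ⟨_, _⟩ := T₁_bd ha2
    obtain ⟨_, _⟩ := R₁_bd hb2; obtain ⟨_, _⟩ := Q₁_bd ha3; obtain ⟨_, _⟩ := I₀_bd hb3
    omega
  -- (X₂,Y₂,Z₁)
  · obtain ⟨_, _⟩ := T₂_bd ha1; obtain ⟨_, _⟩ := Q₁_bd hb1; obtain ⟨_, _⟩ := I₀_bd ha2
    obtain ⟨_, _⟩ := T₂_bd hb2; obtain ⟨_, _⟩ := T₁_bd ha3; obtain ⟨_, _⟩ := I₀_bd hb3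
    omega
  -- (X₂,Y₂,Z₂): intended pattern 2
  · obtain ⟨_, _⟩ := T₂_bd ha1; obtain ⟨_, _⟩ := Q₁_bd hb1; obtain ⟨_, _⟩ := I₀_bd ha2
    obtain ⟨_, _⟩ := T₂_bd hb2; obtain ⟨_, _⟩ := Q₁_bd ha3; obtain ⟨_, _⟩ := I₀_bd hb3
    exact Or.inr ⟨a2, b1, a1, I₀_bd ha2, Q₁_bd hb1, T₂_bd ha1, by omega, by omega, by omega⟩

/-- System (1): for fixed `a' ∈ X`, `b' ∈ Y` at most one `c`. -/
theorem sys1 : ∀ a' ∈ X, ∀ b' ∈ Y, ∀ c₁ ∈ Z, ∀ c₂ ∈ Z,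
    0 - a' - c₁ ∈ Y → 0 - b' - c₁ ∈ X → 0 - a' - c₂ ∈ Y → 0 - b' - c₂ ∈ X → c₁ = c₂ := by
  intro a' ha' b' hb' c₁ hc₁ c₂ hc₂ h1 h2 h3 h4
  have T1 := tri ha' h1 hc₁ (by ring); have T2 := tri h2 hb' hc₁ (by ring)
  have T3 := tri ha' h3 hc₂ (by ring); have T4 := tri h4 hb' hc₂ (by ring)
  rcases T1 with ⟨p1, q1, r1, ⟨lp1, up1⟩, ⟨lq1, uq1⟩, ⟨lr1, ur1⟩, ea1, -, ec1⟩ | ⟨p1, q1, r1, ⟨lp1, up1⟩, ⟨lq1, uq1⟩, ⟨lr1, ur1⟩, ea1, -, ec1⟩ <;>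
  rcases T2 with ⟨p2, q2, r2, ⟨lp2, up2⟩, ⟨lq2, uq2⟩, ⟨lr2, ur2⟩, -, eb2, ec2⟩ | ⟨p2, q2, r2, ⟨lp2, up2⟩, ⟨lq2, uq2⟩, ⟨lr2, ur2⟩, -, eb2, ec2⟩ <;>
  rcases T3 with ⟨p3, q3, r3, ⟨lp3, up3⟩, ⟨lq3, uq3⟩, ⟨lr3, ur3⟩, ea3, -, ec3⟩ | ⟨p3, q3, r3, ⟨lp3, up3⟩, ⟨lq3, uq3⟩, ⟨lr3, ur3⟩, ea3, -, ec3⟩ <;>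
  rcases T4 with ⟨p4, q4, r4, ⟨lp4, up4⟩, ⟨lq4, uq4⟩, ⟨lr4, ur4⟩, -, eb4, ec4⟩ | ⟨p4, q4, r4, ⟨lp4, up4⟩, ⟨lq4, uq4⟩, ⟨lr4, ur4⟩, -, eb4, ec4⟩ <;>
  omega

/-- System (2): for fixed `a' ∈ X`, `c' ∈ Z` at most one `b`. -/
theorem sys2 : ∀ a' ∈ X, ∀ c' ∈ Z, ∀ b₁ ∈ Y, ∀ b₂ ∈ Y,
    0 - a' - b₁ ∈ Z → 0 - c' - b₁ ∈ X → 0 - a' - b₂ ∈ Z → 0 - c' - b₂ ∈ X → b₁ = b₂ := by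
  intro a' ha' c' hc' b₁ hb₁ b₂ hb₂ h1 h2 h3 h4
  have T1 := tri ha' hb₁ h1 (by ring); have T2 := tri h2 hb₁ hc' (by ring)
  have T3 := tri ha' hb₂ h3 (by ring); have T4 := tri h4 hb₂ hc' (by ring)
  rcases T1 with ⟨p1, q1, r1, ⟨lp1, up1⟩, ⟨lq1, uq1⟩, ⟨lr1, ur1⟩, ea1, eb1, -⟩ | ⟨p1, q1, r1, ⟨lp1, up1⟩, ⟨lq1, uq1⟩, ⟨lr1, ur1⟩, ea1, eb1, -⟩ <;>
  rcases T2 with ⟨p2, q2, r2, ⟨lp2, up2⟩, ⟨lq2, uq2⟩, ⟨lr2, ur2⟩, -, eb2, ec2⟩ | ⟨p2, q2, r2, ⟨lp2, up2⟩, ⟨lq2, uq2⟩, ⟨lr2, ur2⟩, -, eb2, ec2⟩ <;>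
  rcases T3 with ⟨p3, q3, r3, ⟨lp3, up3⟩, ⟨lq3, uq3⟩, ⟨lr3, ur3⟩, ea3, eb3, -⟩ | ⟨p3, q3, r3, ⟨lp3, up3⟩, ⟨lq3, uq3⟩, ⟨lr3, ur3⟩, ea3, eb3, -⟩ <;>
  rcases T4 with ⟨p4, q4, r4, ⟨lp4, up4⟩, ⟨lq4, uq4⟩, ⟨lr4, ur4⟩, -, eb4, ec4⟩ | ⟨p4, q4, r4, ⟨lp4, up4⟩, ⟨lq4, uq4⟩, ⟨lr4, ur4⟩, -, eb4, ec4⟩ <;>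
  omega

/-- System (3): for fixed `b' ∈ Y`, `c' ∈ Z` at most one `a`. -/
theorem sys3 : ∀ b' ∈ Y, ∀ c' ∈ Z, ∀ a₁ ∈ X, ∀ a₂ ∈ X,
    0 - b' - a₁ ∈ Z → 0 - c' - a₁ ∈ Y → 0 - b' - a₂ ∈ Z → 0 - c' - a₂ ∈ Y → a₁ = a₂ := by
  intro b' hb' c' hc' a₁ ha₁ a₂ ha₂ h1 h2 h3 h4
  have T1 := tri ha₁ hb' h1 (by ring); have T2 := tri ha₁ h2 hc' (by ring)
  have T3 := tri ha₂ hb' h3 (by ring); have T4 := tri ha₂ h4 hc' (by ring)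
  rcases T1 with ⟨p1, q1, r1, ⟨lp1, up1⟩, ⟨lq1, uq1⟩, ⟨lr1, ur1⟩, ea1, eb1, -⟩ | ⟨p1, q1, r1, ⟨lp1, up1⟩, ⟨lq1, uq1⟩, ⟨lr1, ur1⟩, ea1, eb1, -⟩ <;>
  rcases T2 with ⟨p2, q2, r2, ⟨lp2, up2⟩, ⟨lq2, uq2⟩, ⟨lr2, ur2⟩, ea2, -, ec2⟩ | ⟨p2, q2, r2, ⟨lp2, up2⟩, ⟨lq2, uq2⟩, ⟨lr2, ur2⟩, ea2, -, ec2⟩ <;>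
  rcases T3 with ⟨p3, q3, r3, ⟨lp3, up3⟩, ⟨lq3, uq3⟩, ⟨lr3, ur3⟩, ea3, eb3, -⟩ | ⟨p3, q3, r3, ⟨lp3, up3⟩, ⟨lq3, uq3⟩, ⟨lr3, ur3⟩, ea3, eb3, -⟩ <;>
  rcases T4 with ⟨p4, q4, r4, ⟨lp4, up4⟩, ⟨lq4, uq4⟩, ⟨lr4, ur4⟩, ea4, -, ec4⟩ | ⟨p4, q4, r4, ⟨lp4, up4⟩, ⟨lq4, uq4⟩, ⟨lr4, ur4⟩, ea4, -, ec4⟩ <;>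
  omega

/-- `(X, Y, Z)` is equilateral trapezoid-free for the target `0`. -/
theorem trapezoidFree_XYZ : TrapezoidFree X Y Z 0 := And.intro sys1 (And.intro sys2 sys3)

/-! ## Counting the solutions: `4·4·6 + 4·5·7 = 236` -/

/-- Index set of pattern 1: `(x, y, c) ∈ I₀ × R₁ × T₁`. -/
noncomputable def src1 : Finset (ℤ × ℤ × ℤ) := I₀ ×ˢ R₁ ×ˢ T₁
/-- Index set of pattern 2: `(x, y', z) ∈ I₀ × Q₁ × T₂`. -/
noncomputable def src2 : Finset (ℤ × ℤ × ℤ) := I₀ ×ˢ Q₁ ×ˢ T₂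

/-- `|src1| = 4·4·6 = 96`. -/
theorem card_src1 : src1.card = 96 := by
  simp only [src1, card_product, I₀, R₁, T₁, Int.card_Icc]; rfl
/-- `|src2| = 4·5·7 = 140`. -/
theorem card_src2 : src2.card = 140 := by
  simp only [src2, card_product, I₀, Q₁, T₂, Int.card_Icc]; rfl

attribute [irreducible] src1 src2

/-- Pattern 1 solutions. -/
def emb1 (a : ℤ × ℤ × ℤ) : ℤ × ℤ × ℤ := (5 * a.2.1 + a.1, -30 * a.2.2 - 5 * a.2.1, 30 * a.2.2 - a.1)
/-- Pattern 2 solutions. -/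
def emb2 (a : ℤ × ℤ × ℤ) : ℤ × ℤ × ℤ := (30 * a.2.2 - 5 * a.2.1, a.1 - 30 * a.2.2, 5 * a.2.1 - a.1)

/-- Pattern 1 lands in the solution set. -/
theorem emb1_mem {x y c : ℤ} (hx : x ∈ I₀) (hy : y ∈ R₁) (hc : c ∈ T₁) : emb1 (x, y, c) ∈ solutions X Y Z 0 := by
  rw [emb1, solutions, mem_filter]
  refine ⟨?_, by ring⟩
  simp only [mem_product, X, Y, Z, mem_union]
  exact ⟨Or.inl (mem_X1.2 ⟨y, x, hy, hx, rfl⟩), Or.inl (mem_Y1.2 ⟨c, y, hc, hy, rfl⟩), Or.inl (mem_Z1.2 ⟨c, x, hc, hx, rfl⟩)⟩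

/-- Pattern 2 lands in the solution set. -/
theorem emb2_mem {x y z : ℤ} (hx : x ∈ I₀) (hy : y ∈ Q₁) (hz : z ∈ T₂) : emb2 (x, y, z) ∈ solutions X Y Z 0 := by
  rw [emb2, solutions, mem_filter]
  refine ⟨?_, by ring⟩
  simp only [mem_product, X, Y, Z, mem_union]
  exact ⟨Or.inr (mem_X2.2 ⟨z, y, hz, hy, rfl⟩), Or.inr (mem_Y2.2 ⟨x, z, hx, hz, rfl⟩), Or.inr (mem_Z2.2 ⟨y, x, hy, hx, rfl⟩)⟩

/-- Pattern 1 is injective on its index set (digits are determined). -/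
theorem emb1_injOn : Set.InjOn emb1 (src1 : Set (ℤ × ℤ × ℤ)) := by
  rintro ⟨x, y, c⟩ ha ⟨x', y', c'⟩ ha' h
  rw [mem_coe] at ha ha'
  unfold src1 at ha ha'
  simp only [mem_product] at ha ha'
  obtain ⟨hx, hy, hc⟩ := ha; obtain ⟨hx', hy', hc'⟩ := ha'
  obtain ⟨_, _⟩ := I₀_bd hx; obtain ⟨_, _⟩ := R₁_bd hy; obtain ⟨_, _⟩ := T₁_bd hc
  obtain ⟨_, _⟩ := I₀_bd hx'; obtain ⟨_, _⟩ := R₁_bd hy'; obtain ⟨_, _⟩ := T₁_bd hc'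
  simp only [emb1, Prod.mk.injEq] at h ⊢
  omega

/-- Pattern 2 is injective on its index set. -/
theorem emb2_injOn : Set.InjOn emb2 (src2 : Set (ℤ × ℤ × ℤ)) := by
  rintro ⟨x, y, z⟩ ha ⟨x', y', z'⟩ ha' h
  rw [mem_coe] at ha ha'
  unfold src2 at ha ha'
  simp only [mem_product] at ha ha'
  obtain ⟨hx, hy, hz⟩ := ha; obtain ⟨hx', hy', hz'⟩ := ha'
  obtain ⟨_, _⟩ := I₀_bd hx; obtain ⟨_, _⟩ := Q₁_bd hy; obtain ⟨_, _⟩ := T₂_bd hz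
  obtain ⟨_, _⟩ := I₀_bd hx'; obtain ⟨_, _⟩ := Q₁_bd hy'; obtain ⟨_, _⟩ := T₂_bd hz'
  simp only [emb2, Prod.mk.injEq] at h ⊢
  omega

/-- The two solution families are disjoint (first coordinates: `5y + x ≤ 24 < 35 ≤ 30z - 5y'`). -/
theorem disjoint_images : Disjoint (src1.image emb1) (src2.image emb2) := by
  rw [Finset.disjoint_left]
  intro s h1 h2
  obtain ⟨⟨x, y, c⟩, ha, rfl⟩ := mem_image.1 h1
  obtain ⟨⟨x', y', z'⟩, ha', h⟩ := mem_image.1 h2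
  unfold src1 at ha; unfold src2 at ha'
  simp only [mem_product] at ha ha'
  obtain ⟨hx, hy, hc⟩ := ha; obtain ⟨hx', hy', hz'⟩ := ha'
  obtain ⟨_, _⟩ := I₀_bd hx; obtain ⟨_, _⟩ := R₁_bd hy
  obtain ⟨_, _⟩ := Q₁_bd hy'; obtain ⟨_, _⟩ := T₂_bd hz'
  simp only [emb1, emb2, Prod.mk.injEq] at h
  omega

/-- `a + b + c = 0` has at least `236` solutions in `X × Y × Z`. -/
theorem card_solutions_ge : 236 ≤ (solutions X Y Z 0).card := by
  have h1 : (src1.image emb1).card = 96 := by rw [card_image_of_injOn emb1_injOn, card_src1]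
  have h2 : (src2.image emb2).card = 140 := by rw [card_image_of_injOn emb2_injOn, card_src2]
  have hsub : src1.image emb1 ∪ src2.image emb2 ⊆ solutions X Y Z 0 := by
    intro s hs
    rcases mem_union.1 hs with hs | hs
    · obtain ⟨⟨x, y, c⟩, ha, rfl⟩ := mem_image.1 hs
      unfold src1 at ha
      simp only [mem_product] at ha
      exact emb1_mem ha.1 ha.2.1 ha.2.2
    · obtain ⟨⟨x, y, z⟩, ha, rfl⟩ := mem_image.1 hs
      unfold src2 at ha
      simp only [mem_product] at ha
      exact emb2_mem ha.1 ha.2.1 ha.2.2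
  have := card_le_card hsub
  rw [card_union_of_disjoint disjoint_images, h1, h2] at this
  exact this

/-! ## Bounds and the normal form -/

/-- `X ⊆ [6, 235]`. -/
theorem X_bound : ∀ v ∈ X, 6 ≤ v ∧ v ≤ 235 := by
  intro v hv
  simp only [X, mem_union, mem_X1, mem_X2] at hv
  rcases hv with ⟨a, b, ha, hb, rfl⟩ | ⟨a, b, ha, hb, rfl⟩
  · obtain ⟨_, _⟩ := R₁_bd ha; obtain ⟨_, _⟩ := I₀_bd hb; constructor <;> omega
  · obtain ⟨_, _⟩ := T₂_bd ha; obtain ⟨_, _⟩ := Q₁_bd hb; constructor <;> omega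

/-- `Y ⊆ [-239, -56]`. -/
theorem Y_bound : ∀ v ∈ Y, -239 ≤ v ∧ v ≤ -56 := by
  intro v hv
  simp only [Y, mem_union, mem_Y1, mem_Y2] at hv
  rcases hv with ⟨a, b, ha, hb, rfl⟩ | ⟨a, b, ha, hb, rfl⟩
  · obtain ⟨_, _⟩ := T₁_bd ha; obtain ⟨_, _⟩ := R₁_bd hb; constructor <;> omega
  · obtain ⟨_, _⟩ := I₀_bd ha; obtain ⟨_, _⟩ := T₂_bd hb; constructor <;> omega

/-- `Z ⊆ [1, 209]`. -/
theorem Z_bound : ∀ v ∈ Z, 1 ≤ v ∧ v ≤ 209 := by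
  intro v hv
  simp only [Z, mem_union, mem_Z1, mem_Z2] at hv
  rcases hv with ⟨a, b, ha, hb, rfl⟩ | ⟨a, b, ha, hb, rfl⟩
  · obtain ⟨_, _⟩ := T₁_bd ha; obtain ⟨_, _⟩ := I₀_bd hb; constructor <;> omega
  · obtain ⟨_, _⟩ := Q₁_bd ha; obtain ⟨_, _⟩ := I₀_bd hb; constructor <;> omega

/-- Normal form `A₀ = X - 6` (with `B₀ = Y + 239`, `C₀ = Z - 1`, target `232`). -/
noncomputable def A₀ : Finset ℤ := X.image (· + (-6))
/-- `B₀ = Y + 239`. -/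
noncomputable def B₀ : Finset ℤ := Y.image (· + 239)
/-- `C₀ = Z - 1`. -/
noncomputable def C₀ : Finset ℤ := Z.image (· + (-1))

/-- `Val(232) ≥ 236 > 233`: an equilateral-trapezoid-free triple inside `{0,…,232}` with at least `236` solutions of
`a + b + c = 232` (Pratt's normal form, Def. 4.2).  The star gives only `233`. -/
theorem val_232 :
    (∀ a ∈ A₀, 0 ≤ a ∧ a ≤ 232) ∧ (∀ b ∈ B₀, 0 ≤ b ∧ b ≤ 232) ∧ (∀ c ∈ C₀, 0 ≤ c ∧ c ≤ 232) ∧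
      TrapezoidFree A₀ B₀ C₀ 232 ∧ 236 ≤ (solutions A₀ B₀ C₀ 232).card := by
  refine ⟨?_, ?_, ?_, ?_, ?_⟩
  · intro a ha
    obtain ⟨v, hv, rfl⟩ := mem_image.1 ha
    have := X_bound v hv
    constructor <;> omega
  · intro b hb
    obtain ⟨v, hv, rfl⟩ := mem_image.1 hb
    have := Y_bound v hv
    constructor <;> omega
  · intro c hc
    obtain ⟨v, hv, rfl⟩ := mem_image.1 hc
    have := Z_bound v hv
    constructor <;> omega
  · rw [show (232 : ℤ) = 0 + (-6) + 239 + (-1) by norm_num]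
    exact trapezoidFree_shift (-6) 239 (-1) trapezoidFree_XYZ
  · rw [show (232 : ℤ) = 0 + (-6) + 239 + (-1) by norm_num]
    exact card_solutions_ge.trans (card_solutions_shift (A := X) (B := Y) (C := Z) (t := 0) (-6) 239 (-1))

/-- The same in existential form: `Val(232) ≥ 236`. -/
theorem val_232_exists : ∃ A B C : Finset ℤ,
    (∀ a ∈ A, 0 ≤ a ∧ a ≤ 232) ∧ (∀ b ∈ B, 0 ≤ b ∧ b ≤ 232) ∧ (∀ c ∈ C, 0 ≤ c ∧ c ≤ 232) ∧
      TrapezoidFree A B C 232 ∧ 236 ≤ (solutions A B C 232).card :=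
  ⟨A₀, B₀, C₀, val_232⟩

end Summit.MatrixMultiplication.MatrixMultiplication.Theorems.SoloVal.Small
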